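import Literature.AnabelianGeometry.EtaleTheta.ThetaSystemsStandard
import Literature.AnabelianGeometry.EtaleTheta.Discharge.Sec1Thm110iUniqueModelChiAnchored
import Literature.AnabelianGeometry.EtaleTheta.SettingModelChiCyclotomes
import Literature.AnabelianGeometry.EtaleTheta.SettingModelChiThetaDoubleUnderline
import Literature.AnabelianGeometry.EtaleTheta.ContH1Discrete
import Literature.AnabelianGeometry.EtaleTheta.ContH1Injectivity
import Literature.AnabelianGeometry.EtaleTheta.ContH1ConjAction
import HarnessLib

/-!
# [EtTh] Cor. 2.19 (iii) with the standard-type clause (F-0652 `MuTwoSetting.Cor219_iii_std`) — TOOLS for the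
# kernel refutation of its universal closure at the χ-twisted model: the outer automorphism `(γ, σ) ↦ (θ_{−1} γ, σ)`

S. Mochizuki, *The étale theta function and its Frobenioid-theoretic manifestations*, Publ. RIMS **45**
(2009) [EtTh], §1 p. 12 (`Π^tp_X`, `Δ_Θ ≅ Ẑ(1)`), Prop. 1.5 p. 23 (`log(Ü)`), §2 Def. 2.5 (i) p. 39 / Def. 2.7 p. 41
(the choice `X̲̲`), Cor. 2.19 (iii) p. 65. [cite: MochizukiEtTh2009, Cor 2.19(iii) p.65]

abc-iut cell, block F (FACT-PROVING WAVE), seat abc-iut-f-151 (gen 2), FACT-LIST row **F-0652**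
(`Literature.AnabelianGeometry.EtaleTheta.MuTwoSetting.Cor219_iii_std`, typer abc-iut-L2-t8). PROOF-ONLY companion
(no `def`, no instance; constructions live inside `∃`-proofs) over abc-iut-L2-t1 / abc-iut-w5-d249's χ-twisted root
`ThetaSetting.modelχ p` (`Π^tp_X = Γ ⋊_χ G_{ℚ_p}`, `Γ = F̂₂ ×_Ẑ ℤ`), abc-iut-w5-d024's twists `twist` / `twistGfp`,
abc-iut-L6-d6's `Ẑ`-coordinate `deltaThetaCoordχ` on `Δ_Θ`, abc-iut-w5-d171's `yCoordχ` / `logUddFunχ`, abc-iut-L2-t8's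
`CyclotomeTower`, all consumed BY NAME. Sequel: `Discharge/Sec2Cor219iiiStdSchemaNegative.lean` (the refutation).

CONTENTS.
* §1 `Ẑ` is commutative (`zh_mul_comm`); the inversion `ι : t ↦ t⁻¹` is an automorphism of `Ẑ` commuting with every
  automorphism (`exists_invAut`, `invAut_comm`).
* §2 **`exists_twistAut`**: the OUTER bi-continuous automorphism `Φ : (γ, σ) ↦ (θ_ι γ, σ)` of `Π^tp_X = Γ ⋊_χ G_{ℚ_p}`
  (`a ↦ a`, `b ↦ b⁻¹`, Galois coordinate fixed) — a group automorphism because `θ_ι` commutes with the χ-twists.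
* §3 `Φ` inverts the `y`-coordinate and the `log(Ü)`-cocycle, is over `G_{ℚ_p}`, preserves `Π^tp_Ÿ`, and acts by `−1`
  on `Δ_Θ` (`toTheta_twistAut_of_mem_ker`).
* §4 conjugating a GLOBAL cocycle changes it by a coboundary (`conjNormal_apply_globalCocycle`); an identity in `μ_N`.
* §5 an element of `Δ_Θ ≅ Ẑ` dying at every level of a cyclotome tower is trivial; **compactness of `Δ_Θ` over a
  tower** (`exists_forall_eq_one_of_levelwise`: level-wise solvable closed conditions have a common solution).
* §6 `(1 + p)⁴ ≠ 1` in `K̈^×`; conjugation on `Δ_Θ` factors through the Galois coordinate; **`X̲̲ := X` is an admissible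
  Def. 2.5 (i) choice for `l = 1`** over every étale theta datum of `modelχ` (`exists_doubleUnderline_one`).

HONEST FRAMING: plumbing over a SEMI-SYNTHETIC model (not the tempered `π₁` of a curve); nothing of [EtTh] is
asserted; no side is taken on [IUTchIII] Cor. 3.12; typed ≠ proved.
-/

noncomputable section

namespace Literature.AnabelianGeometry.EtaleTheta.SettingModel

open Literature.AnabelianGeometry.SemiGraphs _root_.Topology _root_.Function

/-! ### §1. `Ẑ` is commutative; the inversion automorphism of `Ẑ` -/

/-- `Ẑ` is commutative (all its finite levels `ℤ/n` are). [cite: RibesZalesskii2010, Thm 2.7.1] -/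
theorem zh_mul_comm (x y : ZH) : x * y = y * x :=
  ZHatLevel.ext_of_level fun n => by rw [map_mul, map_mul, mul_comm]

/-- **The inversion `t ↦ t⁻¹` is an automorphism of `Ẑ`** (commutativity), and it commutes with EVERY automorphism
of `Ẑ`. [cite: RibesZalesskii2010, Thm 2.7.1] -/
theorem exists_invAut : ∃ ι : MulAut ZH, ∀ t : ZH, ι t = t⁻¹ :=
  ⟨{ toFun := fun t => t⁻¹
     invFun := fun t => t⁻¹
     left_inv := fun t => inv_inv t
     right_inv := fun t => inv_inv t
     map_mul' := fun x y => by rw [mul_inv_rev, zh_mul_comm] }, fun _ => rfl⟩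

/-- The inversion commutes with every automorphism of `Ẑ`. [cite: RibesZalesskii2010, Thm 2.7.1] -/
theorem invAut_comm (ι : MulAut ZH) (hι : ∀ t : ZH, ι t = t⁻¹) (φ : MulAut ZH) : ι * φ = φ * ι := by
  ext t
  rw [MulAut.mul_apply, MulAut.mul_apply, hι, hι, map_inv]

variable (p : ℕ) [Fact p.Prime]

/-! ### §2. The outer automorphism `Φ : (γ, σ) ↦ (θ_ι γ, σ)` of `Π^tp_X = Γ ⋊_χ G_{ℚ_p}` -/

/-- **The twist-by-`ι` automorphism of `Π^tp_X = Γ ⋊_χ G_{ℚ_p}` EXISTS as a bi-continuous automorphism**: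
`(γ, σ) ↦ (θ_ι γ, σ)` with `θ_ι` abc-iut-w5-d024's `twistGfp ι` (`a ↦ a`, `b ↦ b^{ι}`), for the inversion `ι` of
`Ẑ` — a group automorphism because `θ_ι` commutes with the χ-twists `θ_{χ(σ)}` (`ι` commutes with `χ(σ)` in
`Aut(Ẑ)`), continuous for the topology induced by `(left, right)`. [cite: MochizukiEtTh2009, §1 p.12] -/
theorem exists_twistAut (ι : MulAut ZH) (hι : ∀ t : ZH, ι t = t⁻¹) :
    ∃ Φ : PiTpχ p ≃ₜ* PiTpχ p, (∀ g, (Φ g).left = twistGfp ι g.left) ∧ (∀ g, (Φ g).right = g.right) := by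
  have hcomm : ∀ σ : GQp p,
      (actχ p σ).trans (twistGfp ι : MulAut Gfp) = (twistGfp ι : MulAut Gfp).trans (actχ p σ) := by
    intro σ
    apply MulEquiv.ext
    intro γ
    change twistGfp ι (twistGfp (chi p σ) γ) = twistGfp (chi p σ) (twistGfp ι γ)
    rw [← MulAut.mul_apply, ← map_mul, invAut_comm ι hι, map_mul, MulAut.mul_apply]
  let Φ₀ : PiTpχ p ≃* PiTpχ p := SemidirectProduct.congr (twistGfp ι : MulAut Gfp) (MulEquiv.refl (GQp p)) hcomm
  have hl : ∀ g, (Φ₀ g).left = twistGfp ι g.left := fun _ => rfl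
  have hr : ∀ g, (Φ₀ g).right = g.right := fun _ => rfl
  have hls : ∀ g, (Φ₀.symm g).left = (twistGfp ι : MulAut Gfp).symm g.left := fun _ => rfl
  have hrs : ∀ g, (Φ₀.symm g).right = g.right := fun _ => rfl
  have hind := isInducing_leftRightχ p
  have hc : Continuous Φ₀ := by
    rw [hind.continuous_iff]
    have h : ((fun g : PiTpχ p => (g.left, g.right)) ∘ Φ₀) =
        Prod.map (twistGfp ι : Gfp → Gfp) id ∘ fun g : PiTpχ p => (g.left, g.right) := by
      funext g; rfl
    rw [h]
    exact ((continuous_twistGfp ι).prodMap continuous_id).comp hind.continuous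
  have hc' : Continuous Φ₀.symm := by
    rw [hind.continuous_iff]
    have h : ((fun g : PiTpχ p => (g.left, g.right)) ∘ Φ₀.symm) =
        Prod.map (twistGfp ι⁻¹ : Gfp → Gfp) id ∘ fun g : PiTpχ p => (g.left, g.right) := by
      funext g
      simp only [Function.comp_apply, Prod.map_apply, id_eq, hls, hrs, map_inv]
      rfl
    rw [h]
    exact ((continuous_twistGfp ι⁻¹).prodMap continuous_id).comp hind.continuous
  exact ⟨{ toMulEquiv := Φ₀, continuous_toFun := hc, continuous_invFun := hc' }, hl, hr⟩

/-! ### §3. Properties of `Φ`: `y`-coordinate, augmentation, `Π^tp_Ÿ`, and `−1` on `Δ_Θ` -/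

section PhiProps

variable {p}
variable (ι : MulAut ZH) (hι : ∀ t : ZH, ι t = t⁻¹) (Φ : PiTpχ p ≃ₜ* PiTpχ p)
  (hΦl : ∀ g, (Φ g).left = twistGfp ι g.left) (hΦr : ∀ g, (Φ g).right = g.right)

include hι hΦl in
/-- **`Φ` inverts the `y`-coordinate**: `ŷ(Φ g) = ŷ(g)⁻¹` (`ê_b ∘ θ_ι = ι ∘ ê_b`). [cite: MochizukiEtTh2009, Prop 1.5 p.23] -/
theorem yCoordχ_twistAut (g : PiTpχ p) : yCoordχ p (Φ g) = (yCoordχ p g)⁻¹ := by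
  unfold yCoordχ
  rw [hΦl, gfpFst_twistGfp, eHatB_twist, hι]

include hΦl in
/-- The level shadows of `Φ g`: `ĥ_N(pr₁ (Φ g).left) = diagTwist (χ_N ι) (ĥ_N (pr₁ g.left))`.
[cite: MochizukiEtTh2009, §1 p.12] -/
theorem hHat_twistAut (N : ℕ+) (g : PiTpχ p) :
    hHat N (gfpFst (Φ g).left) = Heis.diagTwist (ZHatLevel.levelChar N ι) (hHat N (gfpFst g.left)) := by
  rw [hΦl, hHat_gfpFst_twistGfp]

include hΦl hΦr in
/-- **`Φ` preserves `Π^tp_Ÿ`** (levels: `x`, and `y = 0`, are preserved by `diagTwist`; the Galois coordinate is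
fixed). [cite: MochizukiEtTh2009, §1 p.17] -/
theorem twistAut_mem_GtpYdd_iff_aux (g : PiTpχ p) (hg : g ∈ (ThetaSetting.modelχ p).GtpYdd) :
    Φ g ∈ (ThetaSetting.modelχ p).GtpYdd := by
  rw [mem_GtpYdd_modelχ_iff] at hg ⊢
  obtain ⟨h1, h2⟩ := hg
  refine ⟨?_, by rw [hΦr]; exact h2⟩
  rw [YNχ, GfpTwistData.mem_YN] at h1 ⊢
  obtain ⟨h1l, h1r⟩ := h1
  refine ⟨?_, by rw [hΦr]; exact h1r⟩
  rw [dY, Subgroup.mem_inf, MonoidHom.mem_ker, Subgroup.mem_comap] at h1l ⊢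
  obtain ⟨hs, hz⟩ := h1l
  refine ⟨by rw [hΦl, gfpSnd_twistGfp]; exact hs, ?_⟩
  change hHat (2 * 1) (gfpFst (Φ g).left) ∈ Heis.zAxis
  change hHat (2 * 1) (gfpFst g.left) ∈ Heis.zAxis at hz
  rw [hHat_twistAut ι Φ hΦl]
  obtain ⟨hx, hy⟩ := hz
  exact ⟨by rw [Heis.diagTwist_apply]; exact hx, by rw [Heis.diagTwist_apply]; change _ * _ = _; rw [hy, mul_zero]⟩

include hΦr in
/-- `Φ` is OVER `G_{ℚ_p}`: `aug ∘ Φ = aug`. [cite: MochizukiEtTh2009, §1 p.12] -/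
theorem aug_twistAut (g : PiTpχ p) :
    (ThetaSetting.modelχ p).aug (Φ g) = (ThetaSetting.modelχ p).aug g := by
  change (Φ g).right = g.right
  exact hΦr g

include hι hΦl hΦr in
/-- **`Φ` acts on `Δ_Θ` by `−1`**: if `toTheta g ∈ Δ_Θ` (so `g.right = 1` and the level shadows of `g` are
`(0, 0, t mod N)` for the `Ẑ`-coordinate `t` of `toTheta g = c^t`), then `toTheta (Φ g) = c^{ι t} = (c^t)⁻¹`
(`θ_ι` multiplies the `z`-coordinate by `χ_N(ι) = −1`). [cite: MochizukiEtTh2009, §1 p.12] -/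
theorem toTheta_twistAut_of_mem_ker (g : PiTpχ p)
    (hg : CurveTheta.toTheta (curveχ p) g ∈ (CurveTheta.thetaToEll (curveχ p)).ker) :
    CurveTheta.toTheta (curveχ p) (Φ g) = (CurveTheta.toTheta (curveχ p) g)⁻¹ := by
  obtain ⟨t, ht⟩ := exists_cThetaχ_eq_of_mem_ker p hg
  have hright : g.right = 1 :=
    right_eq_one_of_mem_ellKerχ p ((CurveTheta.mk_mem_ker_thetaToEll_iff (curveχ p) g).mp hg)
  have hlev : ∀ N : ℕ+, hHat N (gfpFst g.left) = ⟨0, 0, Multiplicative.toAdd (modN N t)⟩ :=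
    hHat_eq_of_toTheta_eq_cThetaχ p ht.symm
  have hchar : ∀ N : ℕ+, ZHatLevel.levelChar N ι * Multiplicative.toAdd (modN N t) =
      -Multiplicative.toAdd (modN N t) := by
    intro N
    rw [modN_eq_level, ← ZHatLevel.toAdd_level_aut N ι t, hι, map_inv, toAdd_inv]
  have key : CurveTheta.toTheta (curveχ p) (Φ g) =
      CurveTheta.toTheta (curveχ p) (SemidirectProduct.inl (cGfpχ (ι t))) := by
    refine toTheta_eq_of_right_eq_one p _ _ (by rw [hΦr, hright]) (SemidirectProduct.right_inl _) ?_
    rw [mem_closure_commutator₃_iff_forall_hHat]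
    intro N
    rw [map_mul, map_inv, hHat_twistAut ι Φ hΦl, hlev N, SemidirectProduct.left_inl, gfpFst_cGfpχ,
      hHat_apply_of_cPowSpec _ powHat_commutator_spec, hι, map_inv, toAdd_inv]
    ext <;> simp [hchar N]
  rw [key, ← cThetaχ_apply, hι, map_inv, ht]

include hι hΦl in
/-- **`Φ` inverts the `log(Ü)`-cocycle**: `c^{ŷ(Φ x)/2} = (c^{ŷ(x)/2})⁻¹`. [cite: MochizukiEtTh2009, Prop 1.5 p.23] -/
theorem logUddFunχ_twistAut (x : PiTpχ p)
    (h1 : CurveTheta.toTheta (curveχ p) (Φ x) ∈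
      (ThetaSetting.modelχ p).GtpYdd.map (ThetaSetting.modelχ p).toTheta)
    (h2 : CurveTheta.toTheta (curveχ p) x ∈ (ThetaSetting.modelχ p).GtpYdd.map (ThetaSetting.modelχ p).toTheta) :
    logUddFunχ p ⟨CurveTheta.toTheta (curveχ p) (Φ x), h1⟩ =
      (logUddFunχ p ⟨CurveTheta.toTheta (curveχ p) x, h2⟩)⁻¹ := by
  unfold logUddFunχ
  rw [← map_inv, ← map_inv]
  congr 2
  apply Subtype.ext
  exact yCoordχ_twistAut ι hι Φ hΦl x

end PhiProps

/-! ### §4. Two cocycle computations -/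

section Cocycles

open scoped IsMulCommutative

/-- **Conjugating a GLOBAL cocycle changes it by a coboundary**: for `F` a crossed homomorphism on the whole
group, `σ·F(σ⁻¹ h σ) = F(h) · ∂(F σ)(h)` — so inner automorphisms fix restricted global classes.
[cite: NeukirchSchmidtWingberg2008, I §5] -/
theorem conjNormal_apply_globalCocycle {G G' : Type*} [Group G] [Group G'] (φ : G →* G') (A : Subgroup G')
    [A.Normal] [IsMulCommutative A] (F : G → A) (hF : ∀ x y, F (x * y) = F x * MulAut.conjNormal (φ x) (F y))
    (σ h : G) :
    MulAut.conjNormal (φ σ) (F (σ⁻¹ * h * σ)) = F h * (MulAut.conjNormal (φ h) (F σ) * (F σ)⁻¹) := by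
  have h1 : F 1 = 1 := by
    have h := hF 1 1
    simp only [one_mul, map_one, MulAut.one_apply] at h
    exact (mul_eq_left.mp h.symm)
  have hinv : MulAut.conjNormal (φ σ) (F σ⁻¹) = (F σ)⁻¹ := by
    have h := hF σ σ⁻¹
    rw [mul_inv_cancel, h1] at h
    exact eq_inv_of_mul_eq_one_right h.symm
  have e1 : MulAut.conjNormal (φ σ) (MulAut.conjNormal (φ σ⁻¹) (F h)) = F h := by
    rw [← MulAut.mul_apply, ← map_mul, ← map_mul φ, mul_inv_cancel, map_one, map_one, MulAut.one_apply]
  have e2 : MulAut.conjNormal (φ σ) (MulAut.conjNormal (φ (σ⁻¹ * h)) (F σ)) = MulAut.conjNormal (φ h) (F σ) := by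
    rw [← MulAut.mul_apply, ← map_mul, ← map_mul φ, mul_inv_cancel_left]
  rw [hF, hF, map_mul, map_mul, hinv, e1, e2]
  rw [mul_comm (F σ)⁻¹ (F h), mul_assoc, mul_comm (F σ)⁻¹]

/-- Algebra in the roots of unity `μ_N` (the squared form of clause (4) of Cor. 2.19 (iii) against clause (5)):
from `f·c = (a·u⁻¹)⁻¹` and `f² = a²·u²·β` conclude `a⁴·β·c² = 1`. [cite: MochizukiEtTh2009, Cor 2.19(iii) p.65] -/
theorem muN_aux {N : ℕ+} {f c a u β : MuN p N} (h1 : f * c = (a * u⁻¹)⁻¹) (h2 : f ^ 2 = a ^ 2 * u ^ 2 * β) :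
    a ^ 4 * β * c ^ 2 = 1 := by
  have h3 : f = (c * (a * u⁻¹))⁻¹ := by
    rw [mul_inv_rev, ← h1, mul_inv_cancel_right]
  rw [h3, inv_pow] at h2
  have h4 : (c * (a * u⁻¹)) ^ 2 * (a ^ 2 * u ^ 2 * β) = 1 := by rw [← h2, mul_inv_cancel]
  rw [← h4, mul_pow, mul_pow, inv_pow]
  have hu : u ^ 2 * (u ^ 2)⁻¹ = 1 := mul_inv_cancel _
  calc a ^ 4 * β * c ^ 2 = c ^ 2 * (a ^ 2 * a ^ 2) * β * (u ^ 2 * (u ^ 2)⁻¹) := by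
        rw [hu, mul_one, ← pow_add]; rw [mul_comm (c ^ 2), mul_assoc, mul_assoc, mul_comm β, ← mul_assoc]
    _ = c ^ 2 * (a ^ 2 * (u ^ 2)⁻¹) * (a ^ 2 * u ^ 2 * β) := by
        simp only [mul_assoc, mul_comm, mul_left_comm]

end Cocycles

/-! ### §5. `Δ_Θ ≅ Ẑ` has no non-trivial element that is an `N`-th power at cofinally many levels -/

/-- **An element of `Δ_Θ(modelχ)` reducing to `1` in `μ_N` at every level of a (cofinal) cyclotome tower is
trivial** (`red_ker`: it is an `N`-th power for cofinally many `N`; `Δ_Θ ≅ Ẑ` by the `Ẑ`-coordinate and `Ẑ` is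
determined by its levels). [cite: RibesZalesskii2010, Thm 2.7.1] -/
theorem deltaTheta_eq_one_of_forall_red {l : ℕ} {Es : Set ℕ+} (τ : (ThetaSetting.modelχ p).CyclotomeTower l Es)
    (d : (ThetaSetting.modelχ p).DeltaTheta)
    (hd : ((d : (ThetaSetting.modelχ p).GtpTheta)) ∈ (ThetaSetting.modelχ p).lDeltaTheta l)
    (h : ∀ N : Es, (τ.mod N).red ⟨d, hd⟩ = 1) : d = 1 := by
  obtain ⟨t, rfl⟩ := (bijective_deltaThetaCoordχ p).2 d
  suffices ht : t = 1 by subst ht; exact map_one _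
  refine ZHatLevel.ext_of_level fun n => ?_
  rw [map_one]
  obtain ⟨N, hN, hdvd⟩ := τ.cofinal n
  obtain ⟨m, rfl⟩ := hdvd
  obtain ⟨y, hy⟩ := ((τ.mod ⟨n * m, hN⟩).red_ker _).mp (h ⟨n * m, hN⟩)
  obtain ⟨u, hu⟩ := (bijective_deltaThetaCoordχ p).2 ⟨(y : (ThetaSetting.modelχ p).GtpTheta),
    (ThetaSetting.modelχ p).lDeltaTheta_le l y.2⟩
  have hval : cThetaχ p t = cThetaχ p (u ^ ((n * m : ℕ+) : ℕ)) := by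
    have h1 := congrArg Subtype.val hy
    have h2 := congrArg Subtype.val hu
    simp only [coe_deltaThetaCoordχ, Subgroup.coe_pow] at h1 h2
    rw [map_pow, h2]
    exact h1
  have htu : t = u ^ ((n * m : ℕ+) : ℕ) := cThetaχ_injective p hval
  rw [htu, PNat.mul_coe, mul_comm, pow_mul]
  exact ZHatLevel.level_pow_self n (u ^ (m : ℕ))

/-! ### §6. The unit `1 + p` of `K̈ = ℚ_p` is not a `4`-th root of unity -/

/-- `(1 + p)⁴ ≠ 1` in `K̈^×` (read in `ℚ̄_p ⊇ ℕ`, characteristic `0`). [cite: MochizukiEtTh2009, Prop 1.4 (iii) p.22] -/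
theorem onePlusP_pow_four_ne_one : onePlusP p ^ 4 ≠ 1 := by
  intro h
  have h' := congrArg (fun u : (↥(ThetaSetting.modelχ p).Kdd)ˣ => ((u : (ThetaSetting.modelχ p).Kdd) : PadicAlgCl p)) h
  simp only [Units.val_pow_eq_pow_val, SubmonoidClass.coe_pow, coe_onePlusP, Units.val_one,
    OneMemClass.coe_one] at h'
  have h'' : (((1 + p) ^ 4 : ℕ) : PadicAlgCl p) = ((1 : ℕ) : PadicAlgCl p) := by push_cast; exact h'
  have h3 := Nat.cast_injective h''
  have hp2 : 2 ≤ p := (Fact.out : p.Prime).two_le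
  have : 1 < (1 + p) ^ 4 := Nat.one_lt_pow (by norm_num) (by omega)
  omega

/-! ### §7. Conjugation through the Galois coordinate; `X̲̲ := X` for `l = 1`; compactness over a tower -/

section Tools

open scoped IsMulCommutative

/-- Conjugation on `Δ_Θ(modelχ)` factors through the Galois coordinate: `x` and `inr(x.right)` conjugate `Δ_Θ`
identically (`g·c^t·g⁻¹ = c^{χ(aug g)·t}`). [cite: MochizukiEtTh2009, §1 p.12] -/
theorem conjNormal_toTheta_inr_right (x : PiTpχ p) (d : (ThetaSetting.modelχ p).DeltaTheta) :
    MulAut.conjNormal ((ThetaSetting.modelχ p).toTheta (SemidirectProduct.inr x.right)) d =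
      MulAut.conjNormal ((ThetaSetting.modelχ p).toTheta x) d := by
  obtain ⟨t, rfl⟩ := (bijective_deltaThetaCoordχ p).2 d
  have h1 := deltaThetaCoordχ_chi p ((ThetaSetting.modelχ p).toTheta (SemidirectProduct.inr x.right)) t
  have h2 := deltaThetaCoordχ_chi p ((ThetaSetting.modelχ p).toTheta x) t
  exact h1.symm.trans h2


/-- **`X̲̲ := X` is an admissible choice of Def. 2.5 (i) / Def. 2.7 at `modelχ` for `l = 1`**, for EVERY étale theta
datum `E`: `Π^tp_X̲̲ := Π^tp_X` is open, `Π^tp_Ÿ` maps onto `G_K` (`K̈ = K = ℚ_p`), `toZ(Π^tp_X) = ℤ = 1·ℤ`,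
`[Π^tp_Y : Π^tp_Y] = 1`, `Δ_Θ = 1·Δ_Θ`, and any representative of `η̈^Θ` is `1·Δ_Θ`-valued.
[cite: MochizukiEtTh2009, Def 2.7 p.41] -/
theorem exists_doubleUnderline_one (E : (ThetaSetting.modelχ p).EtaleThetaData) :
    ∃ C : E.DoubleUnderline 1, C.Huu = ⊤ := by
  obtain ⟨f, hf⟩ : ∃ f : contCocycles (ThetaSetting.modelχ p).toTheta (ThetaSetting.modelχ p).DeltaTheta
      (ThetaSetting.modelχ p).GtpYdd, (QuotientGroup.mk f : (ThetaSetting.modelχ p).H1 (ThetaSetting.modelχ p).GtpYdd) =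
      E.etaDd := QuotientGroup.mk_surjective _
  have hΔle : (ThetaSetting.modelχ p).DeltaTheta ≤ (ThetaSetting.modelχ p).lDeltaTheta 1 :=
    fun x hx => ⟨x, hx, pow_one x⟩
  refine
    ⟨{ l_odd := ⟨0, rfl⟩, Huu := ⊤, isOpen_Huu := isOpen_univ, map_aug_Ydduu := ?_, map_toZ_Huu := ?_,
       relIndex_Huu_GtpY := ?_, map_toTheta_Huu := ?_, eta_res := ?_ }, rfl⟩
  · apply le_antisymm
    · rintro _ ⟨x, -, rfl⟩
      exact (ThetaSetting.modelχ p).aug_mem_GK x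
    · intro σ _
      exact ⟨SemidirectProduct.inr σ, ⟨inr_mem_GtpYdd_modelχ p σ, Subgroup.mem_top _⟩, rfl⟩
  · rw [← MonoidHom.range_eq_map, MonoidHom.range_eq_top.mpr (ThetaSetting.modelχ p).toZ_surjective]
    refine le_antisymm (fun x _ => ?_) le_top
    refine Subgroup.mem_zpowers_iff.mpr ⟨Multiplicative.toAdd x, ?_⟩
    rw [Nat.cast_one, ← ofAdd_zsmul, smul_eq_mul, mul_one, ofAdd_toAdd]
  · rw [top_inf_eq, Subgroup.relIndex_self]
  · rw [← MonoidHom.range_eq_map, MonoidHom.range_eq_top.mpr (ThetaSetting.modelχ p).toTheta_surjective, top_inf_eq]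
    ext x
    exact ⟨fun hx => ⟨x, hx, pow_one x⟩, fun ⟨y, hy, hyx⟩ => by rw [← hyx, pow_one]; exact hy⟩
  · exact ⟨(ContH1.resCocycle _ _ inf_le_left f).1, (ContH1.resCocycle _ _ inf_le_left f).2,
      fun g => hΔle (f.1 ⟨g.1, g.2.1⟩).2, by rw [← hf]; rfl⟩

/-- **Compactness of `Δ_Θ` over a cyclotome tower**: if at every level `N ∈ E` of a tower (totally ordered by
divisibility) the closed conditions `red_N (P s x) = 1` (`x ∈ Π^tp_Ÿ`, `P` continuous in `s`) have a common
solution `s ∈ Δ_Θ`, then some `s` satisfies `P s x = 1` for all `x` (finite-intersection property of the compact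
`Δ_Θ ≅ Ẑ`, then §5). [cite: RibesZalesskii2010, Thm 2.7.1] -/
theorem exists_forall_eq_one_of_levelwise {Es : Set ℕ+} (τ : (ThetaSetting.modelχ p).CyclotomeTower 1 Es)
    (P : (ThetaSetting.modelχ p).DeltaTheta → PiTpχ p → (ThetaSetting.modelχ p).DeltaTheta)
    (hP : ∀ x, Continuous fun s => P s x)
    (h : ∀ N : Es, ∃ s, ∀ x ∈ (ThetaSetting.modelχ p).GtpYdd,
      (τ.mod N).red ⟨(P s x : (ThetaSetting.modelχ p).GtpTheta), P s x, (P s x).2, pow_one _⟩ = 1) :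
    ∃ s, ∀ x ∈ (ThetaSetting.modelχ p).GtpYdd, P s x = 1 := by
  have hΔle : (ThetaSetting.modelχ p).DeltaTheta ≤ (ThetaSetting.modelχ p).lDeltaTheta 1 :=
    fun x hx => ⟨x, hx, pow_one x⟩
  let ρ : ∀ N : Es, (ThetaSetting.modelχ p).DeltaTheta →* MuN p N := fun N =>
    (τ.mod N).red.comp (Subgroup.inclusion hΔle)
  let Cset : Es → Set (ThetaSetting.modelχ p).DeltaTheta := fun N =>
    ⋂ x ∈ (ThetaSetting.modelχ p).GtpYdd, {s | ρ N (P s x) = 1}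
  have hCmem : ∀ N s, s ∈ Cset N ↔ ∀ x ∈ (ThetaSetting.modelχ p).GtpYdd, ρ N (P s x) = 1 := by
    intro N s
    simp only [Cset, Set.mem_iInter, Set.mem_setOf_eq]
  have hCne : ∀ N, (Cset N).Nonempty := fun N => by
    obtain ⟨s, hs⟩ := h N
    exact ⟨s, (hCmem N s).mpr hs⟩
  have hCcl : ∀ N, IsClosed (Cset N) := by
    intro N
    refine isClosed_biInter fun x _ => ?_
    have hρc : Continuous (ρ N) :=
      (τ.mod N).continuous_red.comp (continuous_induced_rng.2 continuous_subtype_val)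
    exact (isClosed_discrete {(1 : MuN p N)}).preimage (hρc.comp (hP x))
  have hCmono : ∀ N N' : Es, (N : ℕ+) ∣ N' → Cset N' ⊆ Cset N := by
    intro N N' hNN' s hs
    rw [hCmem] at hs ⊢
    intro x hx
    have h1 := congrArg (MuN.red p N N' (PNat.dvd_iff.1 hNN')) (hs x hx)
    rw [map_one] at h1
    rw [← h1]
    exact (τ.red_mod N N' (PNat.dvd_iff.1 hNN') _).symm
  have hCdir : Directed (· ⊇ ·) Cset := by
    intro N N'
    rcases τ.total N N.2 N' N'.2 with h1 | h1
    · exact ⟨N', hCmono N N' h1, subset_rfl⟩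
    · exact ⟨N, subset_rfl, hCmono N' N h1⟩
  haveI : CompactSpace (ThetaSetting.modelχ p).DeltaTheta :=
    isCompact_iff_compactSpace.mp (isCompact_deltaTheta_modelχ p)
  haveI : Nonempty Es := ⟨⟨1, τ.one_mem⟩⟩
  obtain ⟨s, hs⟩ := IsCompact.nonempty_iInter_of_directed_nonempty_isCompact_isClosed Cset hCdir hCne
    (fun N => (hCcl N).isCompact) hCcl
  rw [Set.mem_iInter] at hs
  exact ⟨s, fun x hx => deltaTheta_eq_one_of_forall_red p τ _ (hΔle (P s x).2) fun N => ((hCmem N s).mp (hs N)) x hx⟩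

end Tools

end Literature.AnabelianGeometry.EtaleTheta.SettingModel

end
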